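import Literature.Geometry.Riemannian.ThreePieceGluedMetric
import Literature.Geometry.Riemannian.CollarGluingPieces
import HarnessLib

/-!
# Sub-goal of stub `stub_collarGluingIsometric` (crux `CorkRegluingBudget`, line `registered`,
# RESHAPE 4): gluing along an EMPTY boundary, isometrically on the pieces

Registered sub-goal `exists_pscMetric_of_disjoint_pieces_isometric` of the stub
`stub_collarGluingIsometric` (item stmt-SmoothPoincare4-10831): the empty-boundary branch of the
isometric collar gluing.  If a manifold `P` is covered by two smooth embeddings `jM : M → P`,
`jN : N → P` of compact pieces with DISJOINT images (the gluing of `M` and `N` along an empty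
boundary, `Literature.Topology.FourManifolds.isBoundaryGluing_interiorSum`) and `M`, `N` carry
Riemannian metrics `gM`, `gN` of positive scalar curvature, then `P` carries a Riemannian metric
`g` of positive scalar curvature **with `jM^* g = gM` and `jN^* g = gN`**.  This is the tree's
`Literature.Geometry.Riemannian.exists_pscMetric_of_disjoint_pieces` (O'Neill 1983, Ch. 3,
Prop. 3.59 and Ch. 2, pp. 36–37) with the two piece isometries exported: the metric on the
open-closed image `range jM` is the transport `(jM⁻¹)^* gM`
(`Literature.Geometry.Riemannian.exists_metric_on_openPiece`), and
`((jM⁻¹)^* gM)(djM v, djM w) = gM (v, w)` by the chain rule on `jM⁻¹ ∘ jM = id`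
(`exists_pscMetric_on_openPiece_isometric`); the two fields are glued along the open cover
(`Literature.Geometry.Manifold.OpenSubmanifold.exists_pseudoRiemannianMetric_of_openCover`).
Everything here is proved; no definitions, no named facts.

## References

* B. O'Neill, *Semi-Riemannian Geometry* (1983), Ch. 2, pp. 36–37; Ch. 3, Prop. 3.59.
  [ONeill1983]
-/

set_option linter.dupNamespace false

open scoped Manifold ContDiff Topology
open Set Function Filter

noncomputable section

namespace Summit.SmoothPoincare4.SmoothPoincare4.Theorems.CorkRegluingBudget

open Literature.Geometry.Lorentzian Literature.Geometry.Lorentzian.PseudoRiemannianMetric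
  Literature.Geometry.Riemannian Literature.Geometry.Manifold

universe u

variable {E : Type u} [NormedAddCommGroup E] [NormedSpace ℝ E] [FiniteDimensional ℝ E]
  [CompleteSpace E]
  {H : Type*} [TopologicalSpace H] {I : ModelWithCorners ℝ E H}
  {H' : Type*} [TopologicalSpace H'] {J : ModelWithCorners ℝ E H'}
  {M : Type*} [TopologicalSpace M] [ChartedSpace H M] [IsManifold I ∞ M]
  {P : Type*} [TopologicalSpace P] [ChartedSpace H' P] [IsManifold J ∞ P]

/-- **The transported metric on the open image of a piece, isometrically.**  For a smooth
embedding `j : M → P` (same model vector space), an open `U` of `P` with `U = range j`, and a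
Riemannian metric `gM` of positive scalar curvature on `M`, the open submanifold `U` carries a
Riemannian metric `gU` of positive scalar curvature with Levi-Civita connection — the transport
`(j⁻¹)^* gM` of `exists_metric_on_openPiece` — such that `gU (dj v, dj w) = gM (v, w)` (chain
rule on `j⁻¹ ∘ j = id` through the open submanifold `U`, `d(Subtype.val) = id`).
[cite: ONeill1983, Ch. 3, Prop. 3.59] -/
theorem exists_pscMetric_on_openPiece_isometric {j : M → P}
    (hj : Manifold.IsSmoothEmbedding I J ∞ j)
    (gM : PseudoRiemannianMetric I ∞ E (TangentSpace I : M → Type _)) [gM.HasLeviCivita]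
    (hgM : gM.IsRiemannian) (hSM : ∀ x, 0 < gM.scalarCurvature x)
    (U : TopologicalSpace.Opens P) (hU : (U : Set P) ⊆ range j) (hU' : range j ⊆ (U : Set P)) :
    ∃ gU : PseudoRiemannianMetric J ∞ E (TangentSpace J : U → Type _), ∃ _ : gU.HasLeviCivita,
      gU.IsRiemannian ∧ (∀ u, 0 < gU.scalarCurvature u) ∧
      ∀ (a : M) (ha : j a ∈ U) (v w : TangentSpace I a),
        gU.val ⟨j a, ha⟩ (mfderiv I J j a v) (mfderiv I J j a w) = gM.val a v w := by
  rcases isEmpty_or_nonempty M with hM | hM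
  · haveI : IsEmpty U := ⟨fun u ↦ by
      obtain ⟨b, -⟩ := hU u.2
      exact isEmptyElim b⟩
    obtain ⟨gU, hlc, hR, hS⟩ := exists_pscMetric_of_isEmpty (J := J) (P := U) (E := E)
    exact ⟨gU, hlc, hR, hS, fun a ↦ isEmptyElim a⟩
  obtain ⟨gU, hlc, hval, hR, hS⟩ := exists_metric_on_openPiece hj gM U hU
  refine ⟨gU, hlc, hR hgM, fun u ↦ by rw [hS]; exact hSM _, fun a ha v w ↦ ?_⟩
  have hinj : Injective j := hj.isEmbedding.injective
  -- `j' : M → U`, smooth, with `j⁻¹ ∘ j' = id`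
  set j' : M → U := fun a ↦ ⟨j a, hU' ⟨a, rfl⟩⟩ with hj'_def
  have hj' : ContMDiff I J ∞ j' := (ContMDiff.subtypeVal_comp_iff U j').1 hj.contMDiff
  have hψ : ContMDiff J I ∞ (invFun j ∘ (Subtype.val : U → P)) :=
    contMDiff_invFun_comp_subtype_val hj hU
  have hid : (invFun j ∘ (Subtype.val : U → P)) ∘ j' = id :=
    funext fun a ↦ leftInverse_invFun hinj a
  have hchain := mfderiv_comp a ((hψ _).mdifferentiableAt (by simp))
    ((hj' a).mdifferentiableAt (by simp))
  rw [hid, mfderiv_id] at hchain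
  have hdj : ∀ v : TangentSpace I a, mfderiv I J j a v = mfderiv I J j' a v := fun v ↦ by
    have h2 := mfderiv_comp a (OpenSubmanifold.mdifferentiableAt_subtype_val (I := J) (j' a))
      ((hj' a).mdifferentiableAt (by simp))
    rw [OpenSubmanifold.mfderiv_subtype_val] at h2
    exact DFunLike.congr_fun h2 v
  have key : ∀ v : TangentSpace I a,
      mfderiv J I (invFun j ∘ (Subtype.val : U → P)) (j' a) (mfderiv I J j a v) = v := fun v ↦ by
    rw [hdj v]
    exact (DFunLike.congr_fun hchain v).symm
  rw [hval]
  exact bilin_congr_point_vec gM.val (leftInverse_invFun hinj a) (key v) (key w)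

/-- **Two disjoint compact pieces with positive scalar curvature give positive scalar curvature,
isometrically on the pieces** (registered sub-goal `exists_pscMetric_of_disjoint_pieces_isometric`
of `stub_collarGluingIsometric`: the gluing along an EMPTY boundary, a disjoint union).  If `P`
is covered by smooth embeddings `jM : M → P`, `jN : N → P` of compact manifolds with disjoint
images and `M`, `N` carry Riemannian metrics `gM`, `gN` of positive scalar curvature, then `P`
carries a Riemannian metric `g` of positive scalar curvature with `jM^* g = gM`, `jN^* g = gN`:
transport the metrics to the two open-closed images (`exists_pscMetric_on_openPiece_isometric`)
and glue along the open cover (`exists_pseudoRiemannianMetric_of_openCover`); the scalar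
curvature on each piece by naturality (`exists_metric_comap_of_injective`).
[cite: ONeill1983, Ch. 3, Prop. 3.59] -/
theorem exists_pscMetric_of_disjoint_pieces_isometric :
    ∀ (E : Type) [NormedAddCommGroup E] [NormedSpace ℝ E] [FiniteDimensional ℝ E]
    [CompleteSpace E] (H : Type) [TopologicalSpace H] (I : ModelWithCorners ℝ E H) (H' : Type)
    [TopologicalSpace H'] (J : ModelWithCorners ℝ E H') (M : Type) [TopologicalSpace M]
    [ChartedSpace H M] [IsManifold I ∞ M] [CompactSpace M] (N : Type) [TopologicalSpace N]
    [ChartedSpace H N] [IsManifold I ∞ N] [CompactSpace N] (P : Type) [TopologicalSpace P]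
    [ChartedSpace H' P] [IsManifold J ∞ P] [T2Space P] (jM : M → P) (jN : N → P)
    (gM : Literature.Geometry.Lorentzian.PseudoRiemannianMetric I ∞ E (TangentSpace I : M → Type _))
    [gM.HasLeviCivita]
    (gN : Literature.Geometry.Lorentzian.PseudoRiemannianMetric I ∞ E (TangentSpace I : N → Type _))
    [gN.HasLeviCivita],
    Manifold.IsSmoothEmbedding I J ∞ jM → Manifold.IsSmoothEmbedding I J ∞ jN →
    Set.range jM ∪ Set.range jN = Set.univ → (∀ a b, jM a ≠ jN b) →
    gM.IsRiemannian → (∀ x, 0 < gM.scalarCurvature x) →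
    gN.IsRiemannian → (∀ x, 0 < gN.scalarCurvature x) →
    ∃ (g : Literature.Geometry.Lorentzian.PseudoRiemannianMetric J ∞ E (TangentSpace J : P → Type _))
    (_ : g.HasLeviCivita),
      g.IsRiemannian ∧ (∀ x, 0 < g.scalarCurvature x) ∧
      (∀ a, Literature.Geometry.Lorentzian.pullbackBilin (I := J) (I' := I) jM g.val a = gM.val a) ∧
      (∀ b, Literature.Geometry.Lorentzian.pullbackBilin (I := J) (I' := I) jN g.val b = gN.val b) := by
  intro E _ _ _ _ H _ I H' _ J M _ _ _ _ N _ _ _ _ P _ _ _ _ jM jN gM _ gN _ hjM hjN hcover hdisj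
    hgM hSM hgN hSN
  classical
  have hcM : IsClosed (range jM) := (isCompact_range hjM.isEmbedding.continuous).isClosed
  have hcN : IsClosed (range jN) := (isCompact_range hjN.isEmbedding.continuous).isClosed
  have hMN : range jM = (range jN)ᶜ := by
    ext x
    constructor
    · rintro ⟨a, rfl⟩ ⟨b, hb⟩
      exact hdisj a b hb.symm
    · intro hx
      have hx' : x ∈ range jM ∪ range jN := hcover ▸ mem_univ x
      exact hx'.resolve_right hx
  have hNM : range jN = (range jM)ᶜ := by rw [hMN, compl_compl]
  have hoM : IsOpen (range jM) := by rw [hMN]; exact hcN.isOpen_compl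
  have hoN : IsOpen (range jN) := by rw [hNM]; exact hcM.isOpen_compl
  set U : Bool → TopologicalSpace.Opens P := fun i ↦ cond i ⟨range jM, hoM⟩ ⟨range jN, hoN⟩
    with hU
  obtain ⟨gUM, hlcM, hRM, hSM', hvM⟩ := exists_pscMetric_on_openPiece_isometric hjM gM hgM hSM
    (U true) (fun x hx ↦ hx) (fun x hx ↦ hx)
  obtain ⟨gUN, hlcN, hRN, hSN', hvN⟩ := exists_pscMetric_on_openPiece_isometric hjN gN hgN hSN
    (U false) (fun x hx ↦ hx) (fun x hx ↦ hx)
  -- the two piece metrics as a `Bool`-indexed family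
  have hpiece : ∀ i, ∃ gU : PseudoRiemannianMetric J ∞ E (TangentSpace J : U i → Type _),
      ∃ _ : gU.HasLeviCivita, gU.IsRiemannian ∧ (∀ u, 0 < gU.scalarCurvature u) ∧
      (∀ (a : M) (ha : jM a ∈ U i) (v w : TangentSpace I a),
        gU.val ⟨jM a, ha⟩ (mfderiv I J jM a v) (mfderiv I J jM a w) = gM.val a v w) ∧
      (∀ (b : N) (hb : jN b ∈ U i) (v w : TangentSpace I b),
        gU.val ⟨jN b, hb⟩ (mfderiv I J jN b v) (mfderiv I J jN b w) = gN.val b v w) := by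
    rintro (_ | _)
    · refine ⟨gUN, hlcN, hRN, hSN', fun a ha ↦ ?_, hvN⟩
      have ha' : jM a ∈ range jN := ha
      rw [hNM] at ha'
      exact absurd (mem_range_self a) ha'
    · refine ⟨gUM, hlcM, hRM, hSM', hvM, fun b hb ↦ ?_⟩
      have hb' : jN b ∈ range jM := hb
      rw [hMN] at hb'
      exact absurd (mem_range_self b) hb'
  choose gU hlc hR hS hvM' hvN' using hpiece
  have hcov : ∀ x : P, ∃ i, x ∈ U i := fun x ↦ by
    have hx : x ∈ range jM ∪ range jN := hcover ▸ mem_univ x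
    rcases hx with h | h
    · exact ⟨true, h⟩
    · exact ⟨false, h⟩
  have hcompat : ∀ i j (x : P) (hi : x ∈ U i) (hj : x ∈ U j),
      ((gU i).val ⟨x, hi⟩ : E →L[ℝ] E →L[ℝ] ℝ) = (gU j).val ⟨x, hj⟩ := by
    rintro (_ | _) (_ | _) x hi hj
    · rfl
    · exfalso
      have hj' : x ∈ range jM := hj
      rw [hMN] at hj'
      exact hj' hi
    · exfalso
      have hi' : x ∈ range jM := hi
      rw [hMN] at hi'
      exact hi' hj
    · rfl
  obtain ⟨g, hg⟩ := OpenSubmanifold.exists_pseudoRiemannianMetric_of_openCover U hcov gU hcompat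
  haveI hglc : g.HasLeviCivita := g.hasLeviCivita
  have hgval : ∀ i (x : P) (hi : x ∈ U i) (v w : TangentSpace J x),
      g.val x v w = (gU i).val ⟨x, hi⟩ v w := fun i x hi v w ↦
    DFunLike.congr_fun (DFunLike.congr_fun (hg i ⟨x, hi⟩) v) w
  refine ⟨g, hglc, fun x v hv ↦ ?_, fun x ↦ ?_, fun a ↦ ?_, fun b ↦ ?_⟩
  · obtain ⟨i, hi⟩ := hcov x
    rw [hgval i x hi]
    exact hR i ⟨x, hi⟩ v hv
  · obtain ⟨i, hi⟩ := hcov x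
    have hinj : ∀ u : U i, Injective (mfderiv J J (Subtype.val : U i → P) u) := fun u ↦ by
      rw [OpenSubmanifold.mfderiv_subtype_val]
      exact fun a b h ↦ h
    obtain ⟨gQ, hQlc, hQval, -, hQs⟩ := exists_metric_comap_of_injective
      (Ψ := (Subtype.val : U i → P)) contMDiff_subtype_val hinj g
    have hv : ∀ u, gQ.val u = (gU i).val u := fun u ↦ by
      ext v w
      rw [hQval, OpenSubmanifold.mfderiv_subtype_val]
      exact DFunLike.congr_fun (DFunLike.congr_fun (hg i u) v) w
    have h := hS i ⟨x, hi⟩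
    rw [← scalarCurvature_congr_of_val_eq hv ⟨x, hi⟩, hQs] at h
    exact h
  · ext v w
    rw [pullbackBilin_apply, hgval true (jM a) (mem_range_self a)]
    exact hvM' true a _ v w
  · ext v w
    rw [pullbackBilin_apply, hgval false (jN b) (mem_range_self b)]
    exact hvN' false b _ v w

end Summit.SmoothPoincare4.SmoothPoincare4.Theorems.CorkRegluingBudget

end
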